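import Literature.NumberTheory.Sieve.LargeSieveCharacters
import Mathlib.NumberTheory.Harmonic.Bounds
import HarnessLib

/-!
# The multiplicative large sieve over conductors `> R` with the weight `r⁻²` — proved

A standard consequence of the large sieve for primitive characters (the tree's
`Literature.NumberTheory.Sieve.LargeSieve.largeSieve_character_nat`, Cojocaru–Murty Thm 8.3.1 /
Drappeau's Lemma 3.3) by partial summation: for `a_n` supported on `(M₀, M₀ + N]` and `1 ≤ R`,

`∑_{R < r ≤ Q} r⁻² ∑*_{ψ mod r} |∑_n a_n ψ(n)|² ≤ (2(N + 1)/R² + 6 + 4 log Q) ∑_n |a_n|²`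

(`largeSieve_character_tail`).  This is the step "For all `t > R`, the multiplicative large sieve
inequality … yields `G(t) := ∑_{R<r≤t} ∑_{χ prim mod r} |∑ β_{dn} χ(n)|² ≪ (t² + N)‖β‖²` … We
obtain by partial summation `X₁ − X₃ ≪ (log x)² ∑_d d⁻¹ (G(Q)/Q² + ∫_R^Q G(t) t⁻³ dt)
≪ (log x)^{O(1)} (N + N² R⁻²)`" of S. Drappeau, Proc. London Math. Soc. (3) 114 (2017), §5.6
(arXiv:1504.05549, p. 21), isolated as a reusable inequality with explicit constants: the saving
`R⁻²` on the `N`-term is what makes the conductor cut-off `cond χ > R` of Drappeau's kernel `𝔲_R`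
profitable.  The partial summation is done discretely: `r⁻² = (Q+1)⁻² + ∑_{t=r}^{Q} (t⁻² − (t+1)⁻²)`
(`sum_Icc_inv_sq_sub_inv_sq`), exchange of summations, and the large sieve at each `t`; the
weights satisfy `∑_{t>R} (t⁻² − (t+1)⁻²) ≤ R⁻²` and `2t²(t⁻² − (t+1)⁻²) ≤ 4/t`, whence the harmonic
sum (`harmonic_le_one_add_log`).

## References

* S. Drappeau, Proc. London Math. Soc. (3) 114 (2017) 684–732, arXiv:1504.05549, Lemma 3.3 and
  §5.6. [Drappeau2017]
* A. C. Cojocaru, M. R. Murty, *An Introduction to Sieve Methods and their Applications*, CUP 2005,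
  Thm 8.3.1. [CojocaruMurty2005]
-/

noncomputable section

open Finset Real

namespace Literature.NumberTheory.Sieve.LargeSieve

/-- Telescoping: `∑_{t=r}^{Q} (t⁻² − (t+1)⁻²) = r⁻² − (Q+1)⁻²` for `1 ≤ r ≤ Q + 1`. [folklore] -/
theorem sum_Icc_inv_sq_sub_inv_sq (r : ℕ) (hr : 1 ≤ r) :
    ∀ Q : ℕ, r ≤ Q + 1 →
      ∑ t ∈ Icc r Q, ((((t : ℝ)) ^ 2)⁻¹ - (((t : ℝ) + 1) ^ 2)⁻¹) =
        (((r : ℝ)) ^ 2)⁻¹ - (((Q : ℝ) + 1) ^ 2)⁻¹ := by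
  intro Q
  induction Q with
  | zero =>
    intro hrQ
    have h1 : r = 1 := le_antisymm hrQ hr
    subst h1
    simp
  | succ Q ih =>
    intro hrQ
    rcases Nat.lt_or_ge (Q + 1) r with h | h
    · have hr' : r = Q + 2 := by omega
      subst hr'
      rw [Finset.Icc_eq_empty (by omega), Finset.sum_empty]
      push_cast
      ring
    · rw [Finset.sum_Icc_succ_top h, ih h]
      push_cast
      ring

open scoped Classical in
/-- **The large sieve over conductors `> R` with the weight `r⁻²`**: for complex `a_n` on
`(M₀, M₀ + N]` and `1 ≤ R`,
`∑_{R < r ≤ Q} r⁻² ∑_{ψ mod r primitive} |∑_n a_n ψ(n)|² ≤ (2(N+1)/R² + 6 + 4 log Q) ∑_n |a_n|²`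
(partial summation from the large sieve `∑_{r ≤ t} (r/φ(r)) ∑*_ψ |…|² ≤ (N + 1 + 2t²) ∑|a_n|²`).
[cite: Drappeau2017, Lemma 3.3 and §5.6] -/
theorem largeSieve_character_tail (a : ℕ → ℂ) (M₀ N R Q : ℕ) (hR : 1 ≤ R) :
    ∑ r ∈ Ioc R Q, (((r : ℝ)) ^ 2)⁻¹ *
        ∑ χ : DirichletCharacter ℂ r with χ.IsPrimitive, ‖∑ n ∈ Ioc M₀ (M₀ + N), a n * χ n‖ ^ 2 ≤
      (2 * ((N : ℝ) + 1) / (R : ℝ) ^ 2 + 6 + 4 * Real.log Q) *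
        ∑ n ∈ Ioc M₀ (M₀ + N), ‖a n‖ ^ 2 := by
  classical
  set S := ∑ n ∈ Ioc M₀ (M₀ + N), ‖a n‖ ^ 2 with hS
  have hS0 : 0 ≤ S := Finset.sum_nonneg fun _ _ => by positivity
  have hlog : 0 ≤ Real.log Q := Real.log_natCast_nonneg Q
  have hR0 : (0 : ℝ) < R := by exact_mod_cast hR
  -- `h r = ∑*_ψ |…|²`, `g r = (r/φ(r)) h r ≥ h r`
  set h : ℕ → ℝ := fun r =>
    ∑ χ : DirichletCharacter ℂ r with χ.IsPrimitive, ‖∑ n ∈ Ioc M₀ (M₀ + N), a n * χ n‖ ^ 2 with hh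
  set g : ℕ → ℝ := fun r => (r : ℝ) / r.totient * h r with hg
  have hh0 : ∀ r, 0 ≤ h r := fun r => Finset.sum_nonneg fun _ _ => by positivity
  have hg0 : ∀ r, 0 ≤ g r := fun r =>
    mul_nonneg (div_nonneg (Nat.cast_nonneg _) (Nat.cast_nonneg _)) (hh0 r)
  have hhg : ∀ r, 1 ≤ r → h r ≤ g r := by
    intro r hr1
    have hφ : (0 : ℝ) < r.totient := by exact_mod_cast Nat.totient_pos.2 hr1
    have h1 : (1 : ℝ) ≤ (r : ℝ) / r.totient := by
      rw [le_div_iff₀ hφ, one_mul]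
      exact_mod_cast Nat.totient_le r
    calc h r = 1 * h r := (one_mul _).symm
      _ ≤ g r := mul_le_mul_of_nonneg_right h1 (hh0 r)
  -- the large sieve at level `t`
  have hLS : ∀ t : ℕ, ∑ r ∈ Icc 1 t, g r ≤ ((N : ℝ) + 1 + 2 * (t : ℝ) ^ 2) * S := fun t =>
    largeSieve_character_nat a M₀ N t
  have hinner : ∀ t, ∑ r ∈ Ioc R t, g r ≤ ((N : ℝ) + 1 + 2 * (t : ℝ) ^ 2) * S := fun t =>
    (Finset.sum_le_sum_of_subset_of_nonneg
      (fun r hr => by simp only [mem_Ioc, mem_Icc] at hr ⊢; omega) (fun r _ _ => hg0 r)).trans (hLS t)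
  change ∑ r ∈ Ioc R Q, (((r : ℝ)) ^ 2)⁻¹ * h r ≤
    (2 * ((N : ℝ) + 1) / (R : ℝ) ^ 2 + 6 + 4 * Real.log Q) * S
  clear_value S h g
  -- trivial case: no `r`
  rcases Nat.lt_or_ge Q (R + 1) with hQR | hQR
  · rw [Finset.Ioc_eq_empty (by omega), Finset.sum_empty]
    exact mul_nonneg (by positivity) hS0
  -- main case `R + 1 ≤ Q`; weights `w t = t⁻² − (t+1)⁻² ≥ 0`
  set w : ℕ → ℝ := fun t => (((t : ℝ)) ^ 2)⁻¹ - (((t : ℝ) + 1) ^ 2)⁻¹ with hw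
  have hw0 : ∀ t, 1 ≤ t → 0 ≤ w t := by
    intro t ht
    have ht0 : (0 : ℝ) < t := by exact_mod_cast ht
    exact sub_nonneg.2 (inv_anti₀ (by positivity) (by nlinarith))
  -- Step 1: `h ≤ g` and `r⁻² = (Q+1)⁻² + ∑_{t=r}^{Q} w t`
  have step1 : ∑ r ∈ Ioc R Q, (((r : ℝ)) ^ 2)⁻¹ * h r ≤
      ∑ r ∈ Ioc R Q, (((Q : ℝ) + 1) ^ 2)⁻¹ * g r + ∑ r ∈ Ioc R Q, ∑ t ∈ Icc r Q, w t * g r := by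
    rw [← Finset.sum_add_distrib]
    refine Finset.sum_le_sum fun r hr => ?_
    have hr1 : 1 ≤ r := by have := (mem_Ioc.1 hr).1; omega
    have hrQ : r ≤ Q + 1 := by have := (mem_Ioc.1 hr).2; omega
    have hid : (((r : ℝ)) ^ 2)⁻¹ = (((Q : ℝ) + 1) ^ 2)⁻¹ + ∑ t ∈ Icc r Q, w t := by
      rw [sum_Icc_inv_sq_sub_inv_sq r hr1 Q hrQ]; ring
    calc (((r : ℝ)) ^ 2)⁻¹ * h r ≤ (((r : ℝ)) ^ 2)⁻¹ * g r :=
          mul_le_mul_of_nonneg_left (hhg r hr1) (by positivity)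
      _ = (((Q : ℝ) + 1) ^ 2)⁻¹ * g r + ∑ t ∈ Icc r Q, w t * g r := by
          rw [hid, add_mul, Finset.sum_mul]
  -- Step 2: exchange the summations over `R < r ≤ t ≤ Q`
  have step2 : ∑ r ∈ Ioc R Q, ∑ t ∈ Icc r Q, w t * g r =
      ∑ t ∈ Ioc R Q, w t * ∑ r ∈ Ioc R t, g r := by
    rw [Finset.sum_comm' (s' := fun t => Ioc R t) (t' := Ioc R Q)]
    · exact Finset.sum_congr rfl fun t _ => by rw [Finset.mul_sum]
    · intro r t
      simp only [mem_Ioc, mem_Icc]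
      omega
  -- Step 3: the large sieve inside
  have step3a : ∑ r ∈ Ioc R Q, (((Q : ℝ) + 1) ^ 2)⁻¹ * g r ≤
      (((Q : ℝ) + 1) ^ 2)⁻¹ * (((N : ℝ) + 1 + 2 * (Q : ℝ) ^ 2) * S) := by
    rw [← Finset.mul_sum]
    exact mul_le_mul_of_nonneg_left (hinner Q) (by positivity)
  have step3b : ∑ t ∈ Ioc R Q, w t * ∑ r ∈ Ioc R t, g r ≤
      ∑ t ∈ Ioc R Q, w t * (((N : ℝ) + 1 + 2 * (t : ℝ) ^ 2) * S) :=
    Finset.sum_le_sum fun t ht =>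
      mul_le_mul_of_nonneg_left (hinner t) (hw0 t (by have := (mem_Ioc.1 ht).1; omega))
  -- Step 4: the weight sums
  have hsumw : ∑ t ∈ Ioc R Q, w t ≤ ((R : ℝ) ^ 2)⁻¹ := by
    rw [← Finset.Icc_add_one_left_eq_Ioc, sum_Icc_inv_sq_sub_inv_sq (R + 1) (by omega) Q (by omega)]
    have h1 : ((((R + 1 : ℕ) : ℝ)) ^ 2)⁻¹ ≤ ((R : ℝ) ^ 2)⁻¹ :=
      inv_anti₀ (by positivity) (by push_cast; nlinarith)
    have h2 : 0 ≤ (((Q : ℝ) + 1) ^ 2)⁻¹ := by positivity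
    linarith
  have hsumtw : ∑ t ∈ Ioc R Q, w t * (2 * (t : ℝ) ^ 2) ≤ 4 * (1 + Real.log Q) := by
    have hpt : ∀ t ∈ Ioc R Q, w t * (2 * (t : ℝ) ^ 2) ≤ 4 * ((t : ℝ))⁻¹ := by
      intro t ht
      have ht1 : (1 : ℝ) ≤ t := by exact_mod_cast (show 1 ≤ t by have := (mem_Ioc.1 ht).1; omega)
      have ht0 : (0 : ℝ) < t := by linarith
      have hw' : w t * (2 * (t : ℝ) ^ 2) = 2 * (2 * t + 1) / ((t : ℝ) + 1) ^ 2 := by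
        simp only [hw]
        field_simp
        ring
      rw [hw', div_le_iff₀ (by positivity)]
      have hti : 4 * ((t : ℝ))⁻¹ * ((t : ℝ) + 1) ^ 2 = 4 * t + 8 + 4 * ((t : ℝ))⁻¹ := by
        field_simp
        ring
      rw [hti]
      nlinarith [inv_nonneg.2 ht0.le]
    have hsub : Ioc R Q ⊆ Icc 1 Q := fun t ht => by
      simp only [mem_Ioc, mem_Icc] at ht ⊢; omega
    calc ∑ t ∈ Ioc R Q, w t * (2 * (t : ℝ) ^ 2) ≤ ∑ t ∈ Ioc R Q, 4 * ((t : ℝ))⁻¹ :=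
          Finset.sum_le_sum hpt
      _ ≤ ∑ t ∈ Icc 1 Q, 4 * ((t : ℝ))⁻¹ :=
          Finset.sum_le_sum_of_subset_of_nonneg hsub fun t _ _ => by positivity
      _ = 4 * ((harmonic Q : ℚ) : ℝ) := by
          rw [← Finset.mul_sum, harmonic_eq_sum_Icc]
          push_cast
          rfl
      _ ≤ 4 * (1 + Real.log Q) := mul_le_mul_of_nonneg_left (harmonic_le_one_add_log Q) (by norm_num)
  -- Step 5: assemble
  clear_value w
  have hQ1R : ((R : ℝ)) ^ 2 ≤ ((Q : ℝ) + 1) ^ 2 := by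
    have : (R : ℝ) ≤ (Q : ℝ) + 1 := by exact_mod_cast (by omega : R ≤ Q + 1)
    nlinarith
  have hA : (((Q : ℝ) + 1) ^ 2)⁻¹ * (((N : ℝ) + 1 + 2 * (Q : ℝ) ^ 2) * S) ≤
      (((N : ℝ) + 1) / (R : ℝ) ^ 2 + 2) * S := by
    rw [← mul_assoc]
    refine mul_le_mul_of_nonneg_right ?_ hS0
    rw [mul_add]
    refine add_le_add ?_ ?_
    · rw [div_eq_mul_inv, mul_comm]
      exact mul_le_mul_of_nonneg_left (inv_anti₀ (by positivity) hQ1R) (by positivity)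
    · rw [← div_eq_inv_mul, div_le_iff₀ (by positivity)]
      have hQ0 : (0 : ℝ) ≤ Q := Nat.cast_nonneg Q
      nlinarith
  have hB : ∑ t ∈ Ioc R Q, w t * (((N : ℝ) + 1 + 2 * (t : ℝ) ^ 2) * S) ≤
      (((N : ℝ) + 1) / (R : ℝ) ^ 2 + 4 * (1 + Real.log Q)) * S := by
    have hsplit : ∑ t ∈ Ioc R Q, w t * (((N : ℝ) + 1 + 2 * (t : ℝ) ^ 2) * S) =
        (((N : ℝ) + 1) * ∑ t ∈ Ioc R Q, w t + ∑ t ∈ Ioc R Q, w t * (2 * (t : ℝ) ^ 2)) * S := by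
      rw [Finset.mul_sum, ← Finset.sum_add_distrib, Finset.sum_mul]
      exact Finset.sum_congr rfl fun t _ => by ring
    rw [hsplit]
    refine mul_le_mul_of_nonneg_right (add_le_add ?_ hsumtw) hS0
    rw [div_eq_mul_inv]
    exact mul_le_mul_of_nonneg_left hsumw (by positivity)
  calc ∑ r ∈ Ioc R Q, (((r : ℝ)) ^ 2)⁻¹ * h r
      ≤ ∑ r ∈ Ioc R Q, (((Q : ℝ) + 1) ^ 2)⁻¹ * g r +
          ∑ t ∈ Ioc R Q, w t * ∑ r ∈ Ioc R t, g r := by rw [← step2]; exact step1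
    _ ≤ (((N : ℝ) + 1) / (R : ℝ) ^ 2 + 2) * S +
          (((N : ℝ) + 1) / (R : ℝ) ^ 2 + 4 * (1 + Real.log Q)) * S :=
        add_le_add (step3a.trans hA) (step3b.trans hB)
    _ = (2 * ((N : ℝ) + 1) / (R : ℝ) ^ 2 + 6 + 4 * Real.log Q) * S := by ring

end Literature.NumberTheory.Sieve.LargeSieve

end
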